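import Summits.QuantumFields.YangMills.Theorems.BalabanUVNodesN22WindowOfLocalTerms
import Literature.Analysis.Complex.HolomorphicBanach
import Literature.Analysis.Complex.HolomorphicParametricIntegral

/-!
# BalabanUVNodes ∕ node N22 = NE9 — THE (α)→(β′) LEG IN KERNEL CURRENCY, MODULE J28 (THE ESTIMATE): THE PER-TERM INPUT OF MODULE J27 — a term's polarization kernel (1.20) VANISHES
# off the term's own sites (locality), and for a term that is the real part of a HOLOMORPHIC function of the complexified probe field, bounded by `M` on a ball of radius `r`, the kernel is
# `≤ 16 M r⁻²·‖ι e_x‖‖ι e_y‖` (two Cauchy estimates); applied to the DIFFERENCE of the term at two coupling histories, `M = e^{−κ d(X)} Σ_i Λ_i |g_i − g′_i|` is term-level NE9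

Cell `pub-ymgap`, HUMAN RULING D-0062 (Track A), R134 ACCELERATION re-seat `pub-ymgap-dag-n22-c` (strategy s1), generation 11, file J28.  THEOREMS ONLY; imports J27
`…N22WindowOfLocalTerms` (`polTensor_sub`; through it def-B's `Node00/BetaOfRecord`), lit-balaban's `Literature/Analysis/Complex/HolomorphicBanach` ([Chae1985] Thm 14.13 lane:
`norm_fderiv_fderiv_apply_le`, `differentiableOn_fderiv`, `contDiffOn_of_differentiableOn`) and `…/HolomorphicParametricIntegral` (`norm_fderiv_le_of_forall_mem_ball_norm_le`) BY NAME.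
`--supports` K3⁷ `SpineGivenEndpointR13SepCoPH` (stmt-QuantumFields-20544) as a helper.

WHY.  Module J27 (`YMDAG.N22.WindowOfLocalTerms`, p<J27>) reduces dag-n22-w3's windowed input `hK` of the (1.21) passage (`AtKernels.ne9_EA_of_windowed`) to ONE hypothesis per (1.7)
term: `|Π_X(g)(x,y) − Π_X(g′)(x,y)| ≤ a(X)` when `x, y` are both sites of the term, `0` otherwise.  THIS FILE proves that hypothesis from three PRINT-SHAPED facts about a term
([I] = [Balaban1987RG1]): (L) LOCALITY — the term reads the probe field only on its own sites ([II] (1.34) «restricted to the interior of Y»; [I] (1.7)): then its (1.20) kernel at a pair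
of sites not both its own VANISHES (`polTensor_eq_zero_of_local`: the functional, hence its derivative, is invariant under translations along the foreign one-site direction, so the
line derivative — which IS the Fréchet derivative on that direction — is zero; no differentiability needed); (C) CAUCHY — the term, read through a REAL-LINEAR embedding `ι` of the
probe fields into a COMPLEX normed space, is the real part of a function `G` HOLOMORPHIC on an open set containing the ball of radius `r` about `0` and bounded there by `M` ([I] p.264
«an analytic function … uniformly bounded … together with all derivatives»): then `|Π(x,y)(v,w)| ≤ 16 M r⁻² ‖ι e_{x,v}‖ ‖ι e_{y,w}‖` (`abs_polTensor_le_of_holomorphic`: the real Fréchet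
derivatives of `re ∘ G ∘ ι` are the real parts of `G`'s complex ones — chain rule with `restrictScalars` — and [Chae1985]'s Cauchy inequalities bound `‖DG‖ ≤ 4M∕r` on the half ball and
`‖∂_a ∂_b G(0)‖ ≤ 16M r⁻²‖a‖‖b‖`); (N) TERM-LEVEL NE9 — applied to the DIFFERENCE `G_g − G_{g′}` of the term at two histories, `M := e^{−κ d(X)} Σ_i Λ_i|g_i − g′_i|` is exactly NE9
of the term uniformly on the complexified ball (`abs_polTensor_sub_le_of_holomorphic`).  §4 packages (L)+(C) in module J27's `hterm` shape at def-B's colour-diagonal components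
(`hterm_of_local_holomorphic`), and records that such a term is `ContDiffAt ℝ 2` at `0` (J27's other hypothesis, `contDiffAt_two_of_holomorphic`).

WHAT.  §1 `fderiv_apply_eq_zero_of_invariant_along` · ★ `polTensor_eq_zero_of_local`; §2 `hasFDerivAt_re_comp` · `contDiffAt_two_of_holomorphic` · ★ `abs_polTensor_le_of_holomorphic`;
§3 ★ `abs_polTensor_sub_le_of_holomorphic`; §4 ★ `hterm_of_local_holomorphic`.

HONEST FRAMING — what this is NOT.  Elementary complex analysis (Cauchy inequalities on a Banach ball, [Chae1985]) and calculus; the holomorphic extension `G`, its ball and bound, the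
locality set and the term-level NE9 bound ARE HYPOTHESES — at the datum of record they are NODE A's ∕ N10's ∕ def-W1's (the (1.7) terms of the RG-defined action read through the probe
embedding of [I] (1.20)); nothing of Bałaban's is constructed; N22 NOT discharged (typed 28∕28 · discharged 5∕27 UNCHANGED); NE9 NOT IN PRINT for d = 4; one finite four-torus programme
at fixed ε — NOT infinite volume, NOT OS on ℝ⁴, NOT a mass gap, NOT Clay.  0 `sorry`, 0 `def`, standard axioms.

References (TYPES only): [I] = [Balaban1987RG1] (1.7) p. 261, (1.18) p. 263, (1.20)–(1.21) p. 264; [II] = [Balaban1988RG2Cluster] (1.34) p. 9; S. B. Chae, Holomorphy and Calculus in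
Normed Spaces (1985), 13.6 ∕ Thm 14.13.
-/

noncomputable section

namespace YMDAG.N22.WindowOfLocalTerms

open Filter Metric Set
open scoped BigOperators Topology
open Literature.MathematicalPhysics.QuantumFieldTheory.Balaban1983to89
open Literature.MathematicalPhysics.QuantumFieldTheory.Balaban1983to89.B12PolarizationTensor120 (polTensor polComp expChart)
open Literature.Analysis.Complex (norm_fderiv_le_of_forall_mem_ball_norm_le)
open Literature.Analysis.Complex.HolomorphicBanach (norm_fderiv_fderiv_apply_le differentiableOn_fderiv contDiffOn_of_differentiableOn)
open Literature.Analysis.Complex.SCV (differentiableOn_fderiv_apply)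

/-! ## §1 Locality: a term's polarization kernel vanishes off its own sites -/

section Locality

variable (𝕜 : Type*) [NontriviallyNormedField 𝕜] {E F : Type*} [NormedAddCommGroup E] [NormedSpace 𝕜 E] [NormedAddCommGroup F] [NormedSpace 𝕜 F]

/-- A function invariant under every translation along the line through `e` has Fréchet derivative killing `e` (at a point of differentiability the line derivative along `e` IS
`Df·e` and the restriction to the line is constant; elsewhere `fderiv = 0` by convention). [folklore] -/
theorem fderiv_apply_eq_zero_of_invariant_along {g : E → F} {e : E} (hinv : ∀ (B : E) (s : 𝕜), g (B + s • e) = g B) (B : E) : fderiv 𝕜 g B e = 0 := by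
  by_cases hg : DifferentiableAt 𝕜 g B
  · have h1 : HasDerivAt (fun s : 𝕜 => g (B + s • e)) (fderiv 𝕜 g B e) 0 := hg.hasFDerivAt.hasLineDerivAt e
    have h2 : HasDerivAt (fun s : 𝕜 => g (B + s • e)) 0 0 := by
      have : (fun s : 𝕜 => g (B + s • e)) = fun _ => g B := funext fun s => hinv B s
      rw [this]; exact hasDerivAt_const 0 (g B)
    exact h1.unique h2
  · rw [fderiv_zero_of_not_differentiableAt hg]; rfl

variable {Λ T V : Type*} [Fintype Λ] [Fintype T] [DecidableEq Λ] [DecidableEq T] [NormedAddCommGroup V] [NormedSpace 𝕜 V]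

/-- **★ LOCALITY ⇒ THE KERNEL VANISHES OFF THE TERM'S SITES.**  If a functional of the probe field reads the field only on the sites of `S` — `f B = f B′` whenever `B` and `B′` agree at
every `(λ, t)` with `t ∈ S` ([II] (1.34) «restricted to the interior of Y», [I] (1.7)) — then its polarization tensor (1.20) at a pair of sites `(x, y)` NOT BOTH in `S` is zero, for all
colour directions.  (No differentiability is used: along the foreign one-site direction `f`, and with it `Df`, is translation invariant; `fderiv` of a non-differentiable map is `0`.)
[cite: Balaban1987RG1, (1.7) p.261 and (1.20) p.264; Balaban1988RG2Cluster, (1.34) p.9] -/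
theorem polTensor_eq_zero_of_local (f : (Λ → T → V) → F) (S : Set T) (hloc : ∀ B B' : Λ → T → V, (∀ l, ∀ t ∈ S, B l t = B' l t) → f B = f B')
    {μ : Λ} {x : T} {ν : Λ} {y : T} (hxy : x ∉ S ∨ y ∉ S) (v w : V) : polTensor 𝕜 f μ x v ν y w = 0 := by
  -- a translation along a one-site direction at a foreign site does not change `f`
  have hinv : ∀ {t : T} (_ : t ∉ S) (l : Λ) (u : V) (B : Λ → T → V) (s : 𝕜), f (B + s • (Pi.single l (Pi.single t u) : Λ → T → V)) = f B := by
    intro t ht l u B s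
    refine hloc _ _ fun l' t' ht' => ?_
    have hne : t' ≠ t := fun h => ht (h ▸ ht')
    by_cases hl : l' = l
    · subst hl; simp [Pi.single_eq_of_ne hne]
    · simp [Pi.single_eq_of_ne hl]
  simp only [polTensor]
  rcases hxy with hx | hy
  · -- `Df` itself is invariant along the `x`-direction, so `D(Df)(0)` kills it
    have hinv' : ∀ (B : Λ → T → V) (s : 𝕜), fderiv 𝕜 f (B + s • (Pi.single μ (Pi.single x v) : Λ → T → V)) = fderiv 𝕜 f B := by
      intro B s
      have hfun : (fun B' => f (B' + s • (Pi.single μ (Pi.single x v) : Λ → T → V))) = f := funext fun B' => hinv hx μ v B' s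
      rw [← fderiv_comp_add_right, hfun]
    rw [fderiv_apply_eq_zero_of_invariant_along 𝕜 hinv' 0, _root_.zero_apply]
  · -- `Df(B)` kills the `y`-direction for every `B`, so the map `B ↦ Df(B)·e_y` is zero and so is its derivative
    have hzero : (fun B => fderiv 𝕜 f B (Pi.single ν (Pi.single y w))) = fun _ => 0 :=
      funext fun B => fderiv_apply_eq_zero_of_invariant_along 𝕜 (hinv hy ν w) B
    by_cases hd : DifferentiableAt 𝕜 (fderiv 𝕜 f) 0
    · have h := fderiv_clm_apply hd (differentiableAt_const (Pi.single ν (Pi.single y w)))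
      rw [hzero, fderiv_fun_const, fderiv_fun_const] at h
      simp only [Pi.zero_apply, ContinuousLinearMap.comp_zero, zero_add] at h
      have h' := congrArg (fun L : (Λ → T → V) →L[𝕜] F => L (Pi.single μ (Pi.single x v))) h
      simp only [_root_.zero_apply, ContinuousLinearMap.flip_apply] at h'
      exact h'.symm
    · rw [fderiv_zero_of_not_differentiableAt hd]; rfl

end Locality

/-! ## §2 Cauchy: the kernel of the real part of a holomorphic function of the complexified probe field -/

section Cauchy

variable {Ec : Type*} [NormedAddCommGroup Ec] [NormedSpace ℂ Ec] {P : Type*} [NormedAddCommGroup P] [NormedSpace ℝ P]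

/-- The real Fréchet derivative of `re ∘ G ∘ ι` at a point whose image lies in `G`'s open domain of holomorphy: `D(re G ι)(B)·e = Re (DG(ιB)·(ι e))`
(chain rule, the complex derivative restricted to real scalars). [cite: Balaban1987RG1, (1.20) p.264 (bookkeeping)] -/
theorem hasFDerivAt_re_comp (G : Ec → ℂ) {U : Set Ec} (hG : DifferentiableOn ℂ G U) (hU : IsOpen U) (ι : P →L[ℝ] Ec) {B : P} (hB : ι B ∈ U) :
    HasFDerivAt (fun B' => (G (ι B')).re) (Complex.reCLM.comp (((fderiv ℂ G (ι B)).restrictScalars ℝ).comp ι)) B := by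
  have h1 : HasFDerivAt G (fderiv ℂ G (ι B)) (ι B) := (hG.differentiableAt (hU.mem_nhds hB)).hasFDerivAt
  have h2 : HasFDerivAt (fun B' => G (ι B')) (((fderiv ℂ G (ι B)).restrictScalars ℝ).comp ι) B := (h1.restrictScalars ℝ).comp B ι.hasFDerivAt
  exact Complex.reCLM.hasFDerivAt.comp B h2

/-- Such a functional is twice continuously differentiable over `ℝ` at every point mapped into the domain (module J27's `ContDiffAt ℝ 2` hypothesis): holomorphic maps of Banach spaces
are `C^∞` ([Chae1985] Thm 14.13, `HolomorphicBanach.contDiffOn_of_differentiableOn`), restrict scalars, compose with the continuous linear `ι` and `re`.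
[cite: Balaban1987RG1, (1.20) p.264 (bookkeeping)] -/
theorem contDiffAt_two_of_holomorphic (G : Ec → ℂ) {U : Set Ec} (hG : DifferentiableOn ℂ G U) (hU : IsOpen U) (ι : P →L[ℝ] Ec) {B : P} (hB : ι B ∈ U) :
    ContDiffAt ℝ 2 (fun B' => (G (ι B')).re) B := by
  have h1 : ContDiffAt ℂ 2 G (ι B) := ((contDiffOn_of_differentiableOn hG hU (n := 2)).contDiffAt (hU.mem_nhds hB))
  have h2 : ContDiffAt ℝ 2 G (ι B) := h1.restrict_scalars ℝ
  exact Complex.reCLM.contDiff.contDiffAt.comp B (h2.comp B ι.contDiff.contDiffAt)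

variable {Λ T V : Type*} [Fintype Λ] [Fintype T] [DecidableEq Λ] [DecidableEq T] [NormedAddCommGroup V] [NormedSpace ℝ V]

/-- **★ CAUCHY ⇒ THE KERNEL OF THE REAL PART OF A BOUNDED HOLOMORPHIC FUNCTION OF THE COMPLEXIFIED PROBE FIELD.**  Let `f B = Re G(ι B)` with `ι` a real-linear map of the probe
fields into a complex normed space, `G` holomorphic on an open `U ⊇ ball 0 r` (`r > 0`) and `‖G‖ ≤ M` on that ball.  Then for all sites and colour directions
`|Π_f(x,y)(v,w)| ≤ 16 M r⁻² · ‖ι e_{x,v}‖ · ‖ι e_{y,w}‖` — the first Cauchy inequality gives `‖DG‖ ≤ 4M∕r` on the half ball (`norm_fderiv_le_of_forall_mem_ball_norm_le`), the second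
`‖∂_a ∂_b G(0)‖ ≤ 16 M r⁻² ‖a‖‖b‖` (`HolomorphicBanach.norm_fderiv_fderiv_apply_le`), and the real kernel is the real part of the complex one ([I] p.264 «uniformly bounded … together with all
derivatives»). [cite: Balaban1987RG1, (1.20)-(1.21) p.264] -/
theorem abs_polTensor_le_of_holomorphic (G : Ec → ℂ) {U : Set Ec} (hG : DifferentiableOn ℂ G U) (hU : IsOpen U) {r M : ℝ} (hr : 0 < r) (hrU : ball (0 : Ec) r ⊆ U)
    (hM : ∀ z ∈ ball (0 : Ec) r, ‖G z‖ ≤ M) (ι : (Λ → T → V) →L[ℝ] Ec) (f : (Λ → T → V) → ℝ) (hf : ∀ B, f B = (G (ι B)).re)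
    (μ : Λ) (x : T) (v : V) (ν : Λ) (y : T) (w : V) :
    |polTensor ℝ f μ x v ν y w| ≤ 16 * M / r ^ 2 * ‖ι (Pi.single μ (Pi.single x v))‖ * ‖ι (Pi.single ν (Pi.single y w))‖ := by
  set a : Ec := ι (Pi.single μ (Pi.single x v)) with ha
  set b : Ec := ι (Pi.single ν (Pi.single y w)) with hb
  have hM0 : 0 ≤ M := (norm_nonneg _).trans (hM 0 (mem_ball_self hr))
  have hbound : 0 ≤ 16 * M / r ^ 2 * ‖a‖ * ‖b‖ := by positivity
  -- the first Cauchy inequality on the half ball: ‖DG(z)‖ ≤ 4M/r for ‖z‖ < r/2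
  have hK : ∀ z ∈ ball (0 : Ec) (r / 2), ‖fderiv ℂ G z‖ ≤ 4 * M / r := by
    intro z hz
    have hsub : ball z (r / 2) ⊆ ball (0 : Ec) r := by
      intro z' hz'
      rw [mem_ball_zero_iff]
      rw [mem_ball, dist_eq_norm] at hz'
      rw [mem_ball_zero_iff] at hz
      calc ‖z'‖ = ‖(z' - z) + z‖ := by rw [sub_add_cancel]
        _ ≤ ‖z' - z‖ + ‖z‖ := norm_add_le _ _
        _ < r / 2 + r / 2 := add_lt_add hz' hz
        _ = r := by ring
    have h := norm_fderiv_le_of_forall_mem_ball_norm_le (half_pos hr) (hG.mono (hsub.trans hrU)) fun z' hz' => hM z' (hsub hz')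
    calc ‖fderiv ℂ G z‖ ≤ 2 * M / (r / 2) := h
      _ = 4 * M / r := by field_simp; ring
  -- the second Cauchy inequality: the mixed second derivative
  have hball : ball (0 : Ec) (r / 2) ⊆ U := (ball_subset_ball (by linarith)).trans hrU
  have h2 : ‖fderiv ℂ (fun z => fderiv ℂ G z b) 0 a‖ ≤ 16 * M / r ^ 2 * ‖a‖ * ‖b‖ := by
    have h := norm_fderiv_fderiv_apply_le hG hU (half_pos hr) hball hK b
    calc ‖fderiv ℂ (fun z => fderiv ℂ G z b) 0 a‖ ≤ ‖fderiv ℂ (fun z => fderiv ℂ G z b) 0‖ * ‖a‖ := ContinuousLinearMap.le_opNorm _ _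
      _ ≤ 2 * (4 * M / r) / (r / 2) * ‖b‖ * ‖a‖ := mul_le_mul_of_nonneg_right h (norm_nonneg _)
      _ = 16 * M / r ^ 2 * ‖a‖ * ‖b‖ := by field_simp; ring
  -- the real kernel is the real part of the complex mixed derivative
  have hfun : f = fun B => (G (ι B)).re := funext hf
  -- (i) the first real derivative along `e_y`, at every point mapped into `U`
  have hD1 : ∀ B : Λ → T → V, ι B ∈ U → fderiv ℝ f B (Pi.single ν (Pi.single y w)) = (fderiv ℂ G (ι B) b).re := by
    intro B hB
    rw [hfun, (hasFDerivAt_re_comp G hG hU ι hB).fderiv]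
    rfl
  -- near `0`, `B ↦ Df(B)·e_y` is the real part of the holomorphic `z ↦ DG(z)·b` read through `ι`
  set gw : Ec → ℂ := fun z => fderiv ℂ G z b with hgw
  have hgw_holo : DifferentiableOn ℂ gw U := differentiableOn_fderiv_apply hG hU b
  have hι0 : ι 0 ∈ U := by rw [map_zero]; exact hrU (mem_ball_self hr)
  have hpre : ι ⁻¹' U ∈ 𝓝 (0 : Λ → T → V) := ι.continuous.continuousAt.preimage_mem_nhds (hU.mem_nhds hι0)
  have hev : (fun B => fderiv ℝ f B (Pi.single ν (Pi.single y w))) =ᶠ[𝓝 0] fun B => (gw (ι B)).re :=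
    Filter.mem_of_superset hpre fun B hB => hD1 B hB
  -- (ii) the second real derivative at `0`
  simp only [polTensor]
  by_cases hd : DifferentiableAt ℝ (fderiv ℝ f) 0
  · have h := fderiv_clm_apply hd (differentiableAt_const (Pi.single ν (Pi.single y w)))
    rw [fderiv_fun_const] at h
    simp only [Pi.zero_apply, ContinuousLinearMap.comp_zero, zero_add] at h
    have h' := congrArg (fun L : (Λ → T → V) →L[ℝ] ℝ => L (Pi.single μ (Pi.single x v))) h
    simp only [ContinuousLinearMap.flip_apply] at h'
    -- h' : fderiv ℝ (fun B => fderiv ℝ f B e_y) 0 e_x = fderiv ℝ (fderiv ℝ f) 0 e_x e_y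
    rw [← h', hev.fderiv_eq, (hasFDerivAt_re_comp gw hgw_holo hU ι hι0).fderiv]
    simp only [ContinuousLinearMap.coe_comp, Function.comp_apply, ContinuousLinearMap.coe_restrictScalars', Complex.reCLM_apply, map_zero]
    exact (Complex.abs_re_le_norm _).trans h2
  · rw [fderiv_zero_of_not_differentiableAt hd]
    simpa using hbound

end Cauchy

/-! ## §3 The history difference: term-level NE9 uniform on the complexified ball is the Cauchy bound's `M` -/

section Difference

variable {Ec : Type*} [NormedAddCommGroup Ec] [NormedSpace ℂ Ec]
  {Λ T V : Type*} [Fintype Λ] [Fintype T] [DecidableEq Λ] [DecidableEq T] [NormedAddCommGroup V] [NormedSpace ℝ V]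

/-- **★ THE KERNEL DIFFERENCE AT TWO COUPLING HISTORIES FROM TERM-LEVEL NE9 ON THE COMPLEXIFIED BALL.**  If the term at the histories `g, g′` is the real part of holomorphic `G, G′` on an
open `U ⊇ ball 0 r` read through `ι`, and TERM-LEVEL NE9 holds uniformly on the ball — `‖G z − G′ z‖ ≤ M` there, `M := e^{−κ d(X)} Σ_i Λ_i |g_i − g′_i|` in the application ([I] (1.18),
§5 p.298) — then `|Π_g(x,y)(v,w) − Π_{g′}(x,y)(v,w)| ≤ 16 M r⁻² ‖ι e_{x,v}‖‖ι e_{y,w}‖` (§2 on the difference `G − G′`, module J27's `polTensor_sub`).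
[cite: Balaban1987RG1, (1.18) p.263, (1.20)-(1.21) p.264 and §5 p.298] -/
theorem abs_polTensor_sub_le_of_holomorphic (G G' : Ec → ℂ) {U : Set Ec} (hG : DifferentiableOn ℂ G U) (hG' : DifferentiableOn ℂ G' U) (hU : IsOpen U) {r M : ℝ} (hr : 0 < r)
    (hrU : ball (0 : Ec) r ⊆ U) (hM : ∀ z ∈ ball (0 : Ec) r, ‖G z - G' z‖ ≤ M) (ι : (Λ → T → V) →L[ℝ] Ec)
    (f f' : (Λ → T → V) → ℝ) (hf : ∀ B, f B = (G (ι B)).re) (hf' : ∀ B, f' B = (G' (ι B)).re) (μ : Λ) (x : T) (v : V) (ν : Λ) (y : T) (w : V) :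
    |polTensor ℝ f μ x v ν y w - polTensor ℝ f' μ x v ν y w| ≤ 16 * M / r ^ 2 * ‖ι (Pi.single μ (Pi.single x v))‖ * ‖ι (Pi.single ν (Pi.single y w))‖ := by
  have hι0 : ι 0 ∈ U := by rw [map_zero]; exact hrU (mem_ball_self hr)
  rw [← polTensor_sub ℝ f f' (by rw [show f = fun B => (G (ι B)).re from funext hf]; exact contDiffAt_two_of_holomorphic G hG hU ι (B := 0) hι0)
    (by rw [show f' = fun B => (G' (ι B)).re from funext hf']; exact contDiffAt_two_of_holomorphic G' hG' hU ι (B := 0) hι0)]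
  exact abs_polTensor_le_of_holomorphic (fun z => G z - G' z) (hG.sub hG') hU hr hrU hM ι _ (fun B => by rw [hf, hf', Complex.sub_re]) μ x v ν y w

end Difference

/-! ## §4 The package in module J27's `hterm` shape: locality + Cauchy at def-B's colour-diagonal components of the exponential chart -/

section Package

variable {𝔄 : Type*} [NormedRing 𝔄] [NormedAlgebra ℝ 𝔄] {V : Type*} [NormedAddCommGroup V] [NormedSpace ℝ V] {ι' : Type*}
  {Λ T : Type*} [Fintype Λ] [Fintype T] [DecidableEq Λ] [DecidableEq T] {Ec : Type*} [NormedAddCommGroup Ec] [NormedSpace ℂ Ec]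

/-- **★ MODULE J27's PER-TERM HYPOTHESIS FROM LOCALITY + HOLOMORPHY + TERM-LEVEL NE9.**  For ONE (1.7) term at two histories, read in def-B's exponential chart `B ↦ ℰ(exp ρB)`: if both
charts read the probe field only on the sites of `S` (locality), and are the real parts of functions `G, G′` holomorphic on an open `U ⊇ ball 0 r` of a complex normed space through a
real-linear `ι`, with `‖G − G′‖ ≤ M` on the ball (term-level NE9) and `‖ι e_{x,bV c}‖ ≤ N` for the one-site directions of the colour basis, then for every colour `c`
`|Π^{cc}_ℰ(x,y) − Π^{cc}_{ℰ′}(x,y)| ≤ 𝟙[x, y ∈ S]·16 M N² r⁻²` — the `hterm` of `abs_polScalar_sum_sub_le_twoPointSum` with `a(X) := 16 M N² r⁻²`.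
[cite: Balaban1987RG1, (1.7) p.261, (1.18) p.263 and (1.20)-(1.21) p.264; Balaban1988RG2Cluster, (1.34) p.9] -/
theorem hterm_of_local_holomorphic (ℰ ℰ' : (Λ → T → 𝔄) → ℝ) (ρ : V →L[ℝ] 𝔄) (bV : Module.Basis ι' ℝ V) (S : Set T) [DecidablePred (· ∈ S)]
    (hloc : ∀ B B' : Λ → T → V, (∀ l, ∀ t ∈ S, B l t = B' l t) → expChart ℰ ρ B = expChart ℰ ρ B')
    (hloc' : ∀ B B' : Λ → T → V, (∀ l, ∀ t ∈ S, B l t = B' l t) → expChart ℰ' ρ B = expChart ℰ' ρ B')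
    (G G' : Ec → ℂ) {U : Set Ec} (hG : DifferentiableOn ℂ G U) (hG' : DifferentiableOn ℂ G' U) (hU : IsOpen U) {r M : ℝ} (hr : 0 < r) (hrU : ball (0 : Ec) r ⊆ U)
    (hM : ∀ z ∈ ball (0 : Ec) r, ‖G z - G' z‖ ≤ M) (ι : (Λ → T → V) →L[ℝ] Ec)
    (hf : ∀ B, expChart ℰ ρ B = (G (ι B)).re) (hf' : ∀ B, expChart ℰ' ρ B = (G' (ι B)).re)
    {N : ℝ} (hN : ∀ (l : Λ) (t : T) (c : ι'), ‖ι (Pi.single l (Pi.single t (bV c)))‖ ≤ N)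
    (μ : Λ) (x : T) (ν : Λ) (y : T) (c : ι') :
    |polComp ℝ (expChart ℰ ρ) bV μ x c ν y c - polComp ℝ (expChart ℰ' ρ) bV μ x c ν y c| ≤ if x ∈ S ∧ y ∈ S then 16 * M / r ^ 2 * N ^ 2 else 0 := by
  simp only [polComp]
  split_ifs with hxy
  · have hM0 : 0 ≤ M := by
      have := hM 0 (mem_ball_self hr)
      exact (norm_nonneg _).trans this
    have hN0 : 0 ≤ N := (norm_nonneg _).trans (hN μ x c)
    calc |polTensor ℝ (expChart ℰ ρ) μ x (bV c) ν y (bV c) - polTensor ℝ (expChart ℰ' ρ) μ x (bV c) ν y (bV c)|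
        ≤ 16 * M / r ^ 2 * ‖ι (Pi.single μ (Pi.single x (bV c)))‖ * ‖ι (Pi.single ν (Pi.single y (bV c)))‖ :=
          abs_polTensor_sub_le_of_holomorphic G G' hG hG' hU hr hrU hM ι _ _ hf hf' μ x (bV c) ν y (bV c)
      _ ≤ 16 * M / r ^ 2 * N * N := by
          have h16 : 0 ≤ 16 * M / r ^ 2 := by positivity
          exact mul_le_mul (mul_le_mul_of_nonneg_left (hN μ x c) h16) (hN ν y c) (norm_nonneg _) (mul_nonneg h16 hN0)
      _ = 16 * M / r ^ 2 * N ^ 2 := by ring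
  · have hxy' : x ∉ S ∨ y ∉ S := not_and_or.1 hxy
    rw [polTensor_eq_zero_of_local ℝ _ S hloc hxy', polTensor_eq_zero_of_local ℝ _ S hloc' hxy', sub_zero, abs_zero]

/-- **SOFT EDITION (no locality law).**  For a term read through a NON-local reading of the probe field — the case of record: [I] p. 264 reads
`𝐄^{(j+1)}(g_j, B) = 𝐄^{(j+1)}(g_j, U_{j+1}(exp iB))` through the minimizer, which is not local in `B` but carries exponential tails ([I] p. 282,
the sentence after (4.4): «if one of the functions B_i is localized outside the domain X, then we have the additional exponential factor
exp(−δ₀ dist(X, supp B_i))») — the complexification `ι` carries SITE WEIGHTS `‖ι e_{l,t,c}‖ ≤ w t` (e.g. `w t = e^{−δ₀ dist(t, X)}`: the term is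
holomorphic and bounded on a ball of a weighted sup-norm in which directions far from `X` are cheap), and the Cauchy bound of `abs_polTensor_sub_le_of_holomorphic`
reads `|Δ Π^{cc}_{μν}(x, y)| ≤ 16 M r⁻² w(x) w(y)`: the per-term SOFT kernel(-difference) shape of the (5.10) road (resummed by the polymer-sum leaves of
`B12Decay510`, dag-n22-w2's `…N22WindowSoftTwoPoint`), for J27's two-point schema with `supp := univ`.  No estimate of print is USED here.
[cite: Balaban1987RG1, (1.20) p.264, (4.35)-(4.37) p.282 and (5.10) p.293] [cite: Chae1985, Ch. 15 (Cauchy estimates)] -/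
theorem hterm_of_holomorphic_weighted (ℰ ℰ' : (Λ → T → 𝔄) → ℝ) (ρ : V →L[ℝ] 𝔄) (bV : Module.Basis ι' ℝ V)
    (G G' : Ec → ℂ) {U : Set Ec} (hG : DifferentiableOn ℂ G U) (hG' : DifferentiableOn ℂ G' U) (hU : IsOpen U) {r M : ℝ} (hr : 0 < r) (hrU : ball (0 : Ec) r ⊆ U)
    (hM : ∀ z ∈ ball (0 : Ec) r, ‖G z - G' z‖ ≤ M) (ι : (Λ → T → V) →L[ℝ] Ec)
    (hf : ∀ B, expChart ℰ ρ B = (G (ι B)).re) (hf' : ∀ B, expChart ℰ' ρ B = (G' (ι B)).re)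
    (w : T → ℝ) (hw : ∀ (l : Λ) (t : T) (c : ι'), ‖ι (Pi.single l (Pi.single t (bV c)))‖ ≤ w t)
    (μ : Λ) (x : T) (ν : Λ) (y : T) (c : ι') :
    |polComp ℝ (expChart ℰ ρ) bV μ x c ν y c - polComp ℝ (expChart ℰ' ρ) bV μ x c ν y c| ≤ 16 * M / r ^ 2 * (w x * w y) := by
  simp only [polComp]
  have hM0 : 0 ≤ M := (norm_nonneg _).trans (hM 0 (mem_ball_self hr))
  have hwx : 0 ≤ w x := (norm_nonneg _).trans (hw μ x c)
  have h16 : 0 ≤ 16 * M / r ^ 2 := by positivity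
  calc |polTensor ℝ (expChart ℰ ρ) μ x (bV c) ν y (bV c) - polTensor ℝ (expChart ℰ' ρ) μ x (bV c) ν y (bV c)|
      ≤ 16 * M / r ^ 2 * ‖ι (Pi.single μ (Pi.single x (bV c)))‖ * ‖ι (Pi.single ν (Pi.single y (bV c)))‖ :=
        abs_polTensor_sub_le_of_holomorphic G G' hG hG' hU hr hrU hM ι _ _ hf hf' μ x (bV c) ν y (bV c)
    _ ≤ 16 * M / r ^ 2 * w x * w y :=
        mul_le_mul (mul_le_mul_of_nonneg_left (hw μ x c) h16) (hw ν y c) (norm_nonneg _) (mul_nonneg h16 hwx)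
    _ = 16 * M / r ^ 2 * (w x * w y) := by ring

end Package

end YMDAG.N22.WindowOfLocalTerms

end
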